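import Mathlib
import HarnessLib
import HarnessLib.Audit
import Summits.AtomisticToContinuum.Statement
import Literature.MathematicalPhysics.StatisticalMechanics.LennardJonesClusters
import Literature.MathematicalPhysics.StatisticalMechanics.BarlowStacking
import Summits.AtomisticToContinuum.Crystallization.Theorems.PalmUnimodularRigidityCrysPeriodicBddBelow

/-!
Route: PRDenominatorTransfer

CLOSED (retired) 2026-08-15T13:45:21Z by operator:999:1257524 — reason: not-a-thesis: assembly does not conclude the sub-problem Statement — note: D-0027 §2.1 audit (human 2026-08-15: routes that do not decide the summit are removed): the assembly concludes `Literature.MathematicalPhysics.StatisticalMechanics.Crystallization`, not the sub-problem statement; a NEW conforming route may be opened from the same idea (generated `closes : … → _root_. The file is kept as the record of this route; refuted decls are indexed as negative knowledge (`ledger negatives`).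

# Route PRDenominatorTransfer — scale out the length, localise by weighted Cauchy–Schwarz: the
variance-form participation certificate Σs² ≤ Φ(hcp)·Σt

Write s_i = Σ_{j≠i} r_ij⁻⁶ and t_i = Σ_{j≠i} r_ij⁻¹² for a finite configuration (Lean: `siteEnergy
(fun r => (r⁻¹)^6)`,
`siteEnergy (fun r => (r⁻¹)^12)`). Optimising the dilation gives E(x) ≥ −(Σ_i s_i)²/(24 Σ_i t_i) for
every x, so by
Cauchy–Schwarz it suffices to show X = X1 ∧ X2: (X1, GroundStateVarianceCertificate) there are a
periodic configuration P
(intended: relaxed hcp) and C > 0 with e_LJ(P) ≤ −C/24 such that every Lennard-Jones ground state in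
ℝ³ satisfies the
VARIANCE-FORM PARTICIPATION CERTIFICATE Σ_i s_i² ≤ C·Σ_i t_i; then E(N) ≥ N·e(P) for every N with no
boundary term,
e(P) = min over periodic configurations and E(N)/N → e(P) (conjunct (i) with the minimiser
exhibited); (X2, CrysPositional,
shared item 0625) Blanc–Lewin positional convergence (conjunct (ii)), to which this line contributes
later through the
coercive form of the certificate (two-layer plan). Cards realised:
pr-denominator-transfer-certificate (spine: transfer in
the Cauchy–Schwarz denominator, Στ = Σt), participation-ratio-constant (the scale-free identity
−12E(N) = sup PR).
Lean: `(∃ (P : Literature.MathematicalPhysics.StatisticalMechanics.PeriodicConfiguration 3) (C : ℝ),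
0 < C ∧ P.energyPerParticle Literature.MathematicalPhysics.StatisticalMechanics.lennardJones ≤ -(C /
24) ∧ ∀ (N : ℕ) (x : Fin N → EuclideanSpace ℝ (Fin 3)),
Literature.MathematicalPhysics.StatisticalMechanics.IsGroundState
Literature.MathematicalPhysics.StatisticalMechanics.lennardJones x → ∑ i,
(Literature.MathematicalPhysics.StatisticalMechanics.siteEnergy (fun r => (r⁻¹) ^ 6) x i) ^ 2 ≤ C *
∑ i, Literature.MathematicalPhysics.StatisticalMechanics.siteEnergy (fun r => (r⁻¹) ^ 12) x i) ∧
Literature.MathematicalPhysics.StatisticalMechanics.IsCrystallizing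
Literature.MathematicalPhysics.StatisticalMechanics.lennardJones 3`

## Assembly
Standard reductions only. From GroundStateVarianceCertificate take P, C; ground states exist for
every N
(LennardJonesGroundStatesExist_holds, proved), so CertificateBoundsEnergy gives E(N)/N ≥ −C/24 ≥
e(P) for N ≥ 1; CrysPeriodicBddBelow
gives ⨅_Q e(Q) ≤ e(P) (ciInf_le) and CrysEnergyUpper gives limsup E(N)/N ≤ ⨅_Q e(Q); with
BlancLewin2015_8_holds (E(N)/N converges,
proved) the squeeze yields lim E(N)/N = ⨅_Q e(Q) = e(P) = −C/24 and IsLeast at P, i.e.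
HasPeriodicGroundStateEnergy lennardJones 3;
together with CrysPositional this is Crystallization (as in
crystallization_of_isLeast_tendsto_isCrystallizing).

Rationale: WHY THIS LINE. For V = r⁻¹²/12 − r⁻⁶/6 the dilation trick (LennardJonesIngham1925, KiharaKoba1952
for lattices; card participation-ratio-constant
for all configurations) makes −12·E(N) = sup_{|X|=N} PR(X), PR = (Σ_{i<j} r⁻⁶)²/Σ_{i<j} r⁻¹², a
dimensionless participation
ratio; the spine card localises it by Cauchy–Schwarz with FREE weights τ_i, Στ_i = Σt_i (method of
parameters), moved by a
local transfer so that s_i² ≤ Φ*τ_i at every centre. Planner's observation fixing the route shape: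
weights exist for a
configuration iff Σ_i s_i² ≤ Φ*Σ_i t_i, and exactly Ψ := Σs²/Σt = 2PR/N + Var(s)/mean(t), so the
mechanism necessarily
proves the VARIANCE FORM (Q), stronger than conjunct (i) by a site-variance term and equivalent to
"hcp is a zero-energy
ground state of the degree −12 homogeneous hinge Hamiltonian Σ_i[Φ*t_i − Σ_{j,k} r_ij⁻⁶r_ik⁻⁶]"; in
this bookkeeping crowding
is self-penalising (t ∝ r⁻¹²) instead of favourable, which is what evades the one-centre failure
behind Yuhjtman2015's
14.316 vs 8.61. Imported: inequalities/method of parameters (Hardy–Littlewood–Pólya ch. IX),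
discharging-style transfers
(Hales2012 / Flyspeck), lattice-sum energetics (BeterminSamajTravenec2022, Betermin2023); no prior
route uses a scale-free
functional or a certificate valid at every N. Planner checks (this session, pure Python, NOTES.md
§numerics): Ψ(hcp) = 17.222,
fcc 17.220, bcc 16.47, σ 15.76, A15 15.15, C15 14.43; frozen-phonon second variation of Ψ at fcc,
hcp and the 2-D triangular
lattice is negative definite on a Brillouin-zone grid (worst Var/PR-deficit ratio 0.71, 0.65-grid,
0.667); hill-climbing
maximisation of Ψ over N ≤ 38 (3-D) and N ≤ 127 (2-D) points stays below Φ* (10.28 ≪ 17.22; 6.405 <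
6.764, pointwise max 6.755).

RANKED CRUXES. #0 Target (target) — X = GroundStateVarianceCertificate ∧ CrysPositional as in §
Thesis. (why it might fail: (Q) is strictly stronger than conjunct (i) (site-variance term); one
ground-state family with Var(s)/mean(t) above its PR-deficit refutes X1 while crystallization may
still hold; X2 is conjunct (ii) itself.) [BlancLewin2015, Yuhjtman2015, LennardJonesIngham1925,
Stillinger2001]
#2 GroundStateVarianceCertificate (crux) — there are a periodic configuration P of ℝ³ and C > 0 with
e_LJ(P) ≤ −C/24 such that for every N and every Lennard-Jones ground state x of N particles, Σ_i
s_i(x)² ≤ C·Σ_i t_i(x) (card item X_G in its logically equivalent weight-free form; intended P =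
relaxed hcp, C = Φ(hcp) = L₆²/L₁₂ = 17.222; forces e(P) = −C/24 = min over periodic configurations).
[difficulty: open-problem] (why it might fail: Ψ = 2PR/N + Var(s)/mean(t): a ground-state family
whose site variance beats its PR deficit (strained/defective bulk, Frank–Kasper-like or modulated
close packings; phonon-test margin only 0.29) refutes it even if hcp is the LJ ground state; sharp
far field.) [Yuhjtman2015, BlancLewin2015, Stillinger2001, BeterminSamajTravenec2022, Hales2012,
Literature.Barriers.AtomisticToContinuum.TetrahedralFrustration]
#3 VarianceCertificate (crux) — the same certificate for EVERY finite configuration of distinct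
points in ℝ³ (scale-free, no minimal-distance or ground-state input): ∃ P, C > 0, e_LJ(P) ≤ −C/24 ∧
∀ injective x, Σ_i s_i² ≤ C Σ_i t_i. Equivalently sup_X Σs²/Σt is attained, in the limit, by a
periodic configuration; this is the natural target of a local equivariant transfer rule (the rule
cannot see whether x is a ground state) and implies crux 2 trivially. [difficulty: open-problem]
(why it might fail: adding far points always raises Ψ slightly (halo effect) and s² rewards
heterogeneity: an engineered multi-scale finite configuration (compressed core, weightless
periphery, interfaces of two densities) might push Σs²/Σt above Φ(hcp) although no ground state
does.) [LennardJonesIngham1925, KiharaKoba1952, Yuhjtman2015, BlancLewin2015,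
Literature.Barriers.AtomisticToContinuum.IcosahedralClusters]
#4 PlanarVarianceCertificate (crux) — the planar rung: ∃ P : PeriodicConfiguration 2 (intended:
triangular lattice, Φ_tri = L₆²/L₁₂ = 6.3759²/6.0098 = 6.764), C > 0, e_LJ(P) ≤ −C/24 ∧ ∀ finite
injective x ⊂ ℝ², Σ s_i² ≤ C Σ t_i. Gives conjunct (i) for the TRUE (12,6) potential in d = 2, which
Theil2006's hypotheses exclude; the kissing configuration (hexagon) is rigid there, so this is where
a transfer-free or one-transfer proof should exist if the mechanism is real. [difficulty: L] (why it
might fail: same variance strengthening in d = 2 (phonon ratio 2/3 exactly at long waves, margin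
1/3); planner's hill-climb reached Ψ = 6.405 at N = 127 still rising (pointwise max 6.755 < 6.764):
a large engineered cluster could cross Φ_tri.) [Theil2006, BlancLewin2015, Betermin2023,
BeterminZhang2015, Literature.Barriers.AtomisticToContinuum.LocalizedPotentialsExcludeLennardJones]
#5 LatticeQuotientBound (crux) — the variance-free slice, pinned to hcp: there are a, h ≠ 0 such
that for every Bravais lattice L of ℝ³ (periodic configuration with one-point motif) L₆(L)² ≤
(−24·e_LJ(hcp_{a,h}))·L₁₂(L), i.e. no Bravais lattice at any density beats relaxed hcp for
Lennard-Jones (expected: max_L L₆²/L₁₂ = Φ(fcc) = 17.2203 < 17.2225 ≈ Φ(relaxed hcp); certified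
lattice sums + a 5-parameter optimisation over lattice shapes with cusp asymptotics). [difficulty:
M] (why it might fail: asserts two open facts at once: fcc maximises L₆²/L₁₂ among 3-D lattices
(only numerics, BeterminSamajTravenec2022) and e(hcp) < e(fcc) for full-range LJ by a 1e-4 relative
margin (Stillinger2001); a non-cubic lattice inside that margin kills it.)
[BeterminSamajTravenec2022, Betermin2023, Stillinger2001, KiharaKoba1952,
Literature.Barriers.AtomisticToContinuum.NoUniversallyOptimalLattice3D,
Literature.Barriers.AtomisticToContinuum.HcpNotBravais]
#6 CrysPositional (crux) — Blanc–Lewin positional crystallization for Lennard-Jones in ℝ³ (conjunct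
(ii); shared item stmt-AtomisticToContinuum-0625 of routes CrystalLocalRigidity /
CrystalKissingRigidity). This route consumes it in the assembly and feeds it later through the
coercive certificate (two-layer plan), it does not decompose it now. [deps:
GroundStateVarianceCertificate] [difficulty: open-problem] (why it might fail: it is half the
conjecture: stacking-disordered ground states without periodic windows of diverging size
(third-shell selection J₂ < 0 uncertified, Hägg domination 0737 open) would refute it while (i)
survives.) [BlancLewin2015, FlatleyTheil2015,
Literature.Barriers.AtomisticToContinuum.KissingTwelveDegeneracy,
Literature.Barriers.AtomisticToContinuum.ShortRangeStackingBlindness]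
#9 CertificateBoundsEnergy (support) — Cauchy–Schwarz + dilation, pure algebra in any dimension: if
0 ≤ C and Σ_i s_i² ≤ C Σ_i t_i for an injective configuration x of N points, then interactionEnergy
lennardJones x ≥ −(C/24)·N (proof: with A = Σ_{i<j} r⁻⁶ = ½Σs_i, B = Σ_{i<j} r⁻¹² = ½Σt_i > 0 one
has E = B/12 − A/6 = (B − A)²/(12B) − A²/(12B) ≥ −A²/(12B), and (Σ s_i)² ≤ N Σ s_i² ≤ N·C·Σ t_i; N ≤
1 is 0 ≤ 0). [difficulty: provable-now] [LennardJonesIngham1925, BlancLewin2015]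
#9 CrysEnergyUpper (support) — trial-state upper bound limsup E(N)/N ≤ ⨅ over periodic Q of e_LJ(Q)
(shared item stmt-AtomisticToContinuum-0629, same signature; coboundedness from
BlancLewin2015_9_holds, now proved in tree). [difficulty: provable-now] [BlancLewin2015]
#9 CrysPeriodicBddBelow (support) — the Lennard-Jones energy per particle of periodic configurations
of ℝ³ is bounded below (shared item stmt-AtomisticToContinuum-0714, same signature; finite blocks +
lennardJones_stable); makes ⨅_Q e(Q) a genuine infimum (ciInf_le). [difficulty: provable-now]
[BlancLewin2015]

TWO-LAYER PLAN. Foreseen glued splits (nothing filed now). VarianceCertificate ⇐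
NearFieldTransferCertificate → FarFieldAccountant → VarianceCertificate:
(near) for configurations normalised to minimal distance 1, an explicit one-parameter equivariant
transfer τ (crowded pairs r_jk ≤ κ·min(r_ij, r_ik)
donate θ·r_jk⁻¹² to common near neighbours) with s_i^{≤R}·(s_i^{≤R} + 2F_i) ≤ Φ*·τ_i certified by
interval branch-and-bound over R-environments,
where the far field F_i is NOT a sup bound (that is false at hcp itself, zero slack) but (far) an
exact positive-type accountant for the r⁻⁶ tail
beyond R (cards bernstein-split-kepler-tail / three-cone-certificate).
GroundStateVarianceCertificate ⇐ CoerciveCertificate → (consumers):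
Σ_i[C t_i − s_i²] ≥ c·Σ_{i bad} t_i with "bad" = first shell not η-close to twelve at the
nearest-neighbour distance, which with the upper bound
gives SoftTwelveCoordination (item 0750 of CrystalKissingRigidity) and is this line's contribution
to CrysPositional. PlanarVarianceCertificate
⇐ pointwise-with-one-transfer planar inequality → summation.

KILL CRITERIA. A finite configuration (any N) with Σs²/Σt > 17.2225 (= Φ of relaxed hcp; e.g. from
the Cambridge Cluster Database, Frank–Kasper approximants,
modulated close packings) refutes VarianceCertificate; if it is (close to) a Lennard-Jones ground
state it refutes GroundStateVarianceCertificate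
too and the route is closed `refuted:GroundStateVarianceCertificate` (the PR framework then survives
only as the weaker per-configuration bound
2PR/N ≤ Φ*, i.e. conjunct (i) restated — not a route). A configuration with 2PR/N > 17.2225 refutes
conjunct (i) for hcp outright (hand to
RefuteCrystalPeriodicMin). LatticeQuotientBound refuted by a lattice beating relaxed hcp ⇒ pivot all
witnesses to that structure (the ∃P cruxes
survive). PlanarVarianceCertificate refuted ⇒ the transfer mechanism is dead in its easiest habitat:
close unless crux 2 has independent progress.
CrysPeriodicMinAttained (0627) proved elsewhere with the minimiser identified moots the (i)-side
novelty but not the certificate.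

NOT DECOMPOSED YET. The transfer rule (θ, κ), the cut-off R and the far-field accountant (layer-2
children of VarianceCertificate, see two-layer plan); the
coercive/strict form and its consumers on the (ii) side; hcp-vs-fcc inside the certificate (the ∃P
form deliberately leaves the 1e-4 stacking
selection to items 0716/0737/0670); the Mie (2p,p) ladder and its p = ∞ kissing-number anchor (a
separate thesis if pursued); any use of
minimal-distance facts (LennardJonesMinimalDistance_holds is available if crux 2 needs separated
configurations).

CHEAPEST FALSIFIER. Evaluate Ψ = Σ_i s_i²/Σ_i t_i (two inverse-power sums per site, no optimisation
needed) on (a) the putative LJ global minima N ≤ 1610 of the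
Cambridge Cluster Database and (b) LJ-relaxed periodic competitors (dhcp, 9R, Frank–Kasper
A15/σ/C14/C15/Z, β-W, quasicrystal approximants,
bcc/bct paths) and (c) hcp/fcc supercells with random displacements relaxed under the hinge
Hamiltonian H = Σ_i[17.2225·t_i − s_i²] by
gradient descent: any value above 17.2225 kills crux 3 (and crux 2 if the configuration is a ground
state). Planner ran the zero-cost part:
perfect lattices (hcp 17.222, fcc 17.220, bcc 16.47, σ 15.76, A15 15.15, C15 14.43), the
frozen-phonon Hessian test at fcc/hcp/triangular
(passes, worst ratio 0.71) and small-N hill climbs (max 10.28 at N = 38 in 3-D; 6.405 at N = 127 vs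
6.764 in 2-D) — all consistent.

NUMBERS. Φ(hcp) = L₆²/L₁₂ = 14.4549²/12.1323 = 17.2222 (e = −Φ/24 = −0.71759); Φ(fcc) =
14.4539²/12.1319 = 17.2203; relaxed hcp ≈ 17.2225;
bcc 16.474; sc 11.382; σ-phase (Bergman–Shoemaker coordinates, equal atoms) 15.759 (variance term
0.038); A15 15.153 (0.0006); C15 14.433
(0.316); 2-D triangular Φ_tri = 6.3759²/6.0098 = 6.7642. Identity: Ψ(X) = 2PR(X)/N +
Var_X(s)/mean_X(t) (exact). Second variation at a
lattice under u_j = ε ê cos(k·x_j): (Q) holds locally iff M(k) = (s̄²/t̄)D₁₂(k) − 2s̄D₆(k) −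
β(k)β(k)ᵀ ≽ 0 with D_p(k) = Σ_j(1 − cos k·r_j)∇²K_p(r_j),
β(k) = Σ_j sin(k·r_j)∇K₆(r_j): min eigenvalue ≥ 0 on an 8³ grid (fcc) and 6³ grid (hcp, 6×6
Hermitian form incl. optical branches);
long-wave longitudinal ratio Var/deficit = 0.71 [100], 0.52 [110], 0.48 [111] (fcc), 2/3 (2-D).
Known one-centre LJ lower bound: stability
constant ≤ 14.316 vs conjectured 8.61 (Yuhjtman2015). LJ cluster optima: −12E(N)/N = PR/N = 3.41
(13), 5.08 (55), 5.96 (147) ↑ 8.61.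
Items at open: 10 (target, 5 cruxes, 3 support, assembly).

DEFINITION REQUESTS. None: siteEnergy, interactionEnergy, groundStateEnergy, IsGroundState,
PeriodicConfiguration.energyPerParticle, hcpPeriodicConfiguration,
IsCrystallizing, lennardJones all exist (Literature.MathematicalPhysics.StatisticalMechanics); s_i,
t_i are siteEnergy of r ↦ r⁻⁶, r ↦ r⁻¹².

Novelty: Searches (2026-08-15): `lit search --source crossref "Lennard-Jones lattice energy minimization
three dimensions ... optimal"` (15: BeterminZhang2015,
Luo–Wei 2025 doi:10.4171/jems/1682, Burrows–Cooper–Schwerdtfeger 2021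
doi:10.1103/physreve.104.035306, BeterminSamajTravenec2022); `lit search
--source crossref "Yuhjtman stability constant Lennard-Jones"` (doi:10.1007/s10955-015-1300-3); `lit
read arxiv:1504.01153 --grep Theil|lower bound`
(§2.2 p.7 one-centre/minimal-distance literature XueMaiRos-92 … Yuhjtman-15; §2.3 "restrictive
hypotheses on V … not completely understood in
dimension two"); `lit galaxy search "Lennard-Jones lattice sums" --star all` and `"Lennard-Jones
crystal lattice sum" --star all` (0 rows; pdf star
queued out); local hybrid index unreachable this session (searchd reset, arXiv/OpenAlex 429) — the
two cards' own audited searches (novelty audits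
04:26Z/04:36Z) cover crossref/galaxy for the quotient and the transfer. Nearest prior art found:
LennardJonesIngham1925 / KiharaKoba1952 (scale-free
quotient A₆²/A₁₂ for lattices), Yuhjtman2015 (one-centre stability constant 14.316 with a
minimal-distance input), Hales2012 (score transfers),
BeterminSamajTravenec2022 / Betermin2023 (lattice-only LJ energetics, d = 3 numerics / d = 2
computer-assisted proof).
Delta: nobody states or attacks the variance-form inequality Σ_i s_i² ≤ Φ(hcp)Σ_i t_i (equivalently:
hcp is a zero-energy ground state of the
homogeneous 2+3-body hinge Hamiltonian), which is what ANY denomin  [refs: 10.4171/jems/1682, 10.1103/physreve.104.035306, 10.1007/s10955-015-1300-3, 1504.01153, doi:10.4171/jems/1682, doi:10.1103/physreve.104.035306, doi:10.1007/s10955-015-1300-3, arxiv:1504.01153, BeterminZhang2015, BeterminSamajTravenec2022, LennardJonesIngham1925, KiharaKoba1952, Yuhjtman2015, Hales2012, Betermin2023]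

Barriers (technique_class: participation-ratio cs-transfer-certificate variance-form): - technique_class: participation-ratio cs-transfer-certificate variance-form
- Literature.Barriers.AtomisticToContinuum.TetrahedralFrustration: APPLIES to any pointwise
(transfer-free) version — s_i²/t_i is unbounded (n equidistant crowded neighbours give n) and
polytetrahedral centres are local debtors; evaded only in the summed form (Q), where crowded pairs
carry r⁻¹²-mass that pays for the centre (planner estimate: Bergman-type centre debt ≈ 6 vs
first-shell credit ≈ 96); the bet is that ONE equivariant transfer realises this, and the
Rogers/dodecahedral non-sharpness does not transfer because Ψ is not a cell functional and TCP bulk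
phases sit at Ψ ≤ 15.8 ≪ 17.2.
- Literature.Barriers.AtomisticToContinuum.IcosahedralClusters: consistent — finite LJ optima are
icosahedral but have Ψ far below Φ* (2PR/N = 6.8 at N = 13; planner's maximised Ψ ≤ 10.3 for N ≤
38); the certificate is an inequality valid at every N, not a claim that clusters are crystal
fragments.
- Literature.Barriers.AtomisticToContinuum.FlexibleKissingArrangements: not met — no single-shell
pattern inference; equality analysis (coercive form, later) sees all shells through s and t.
- Literature.Barriers.AtomisticToContinuum.KissingTwelveDegeneracy: conceded — the certificate's
equality set cannot separate Barlow stackings better than 1e-4 (Φ(hcp) − Φ(fcc) = 1.9e-3 absolute);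
the ∃P form of cruxes 2–4 does not need to, and stacking selection for (ii) stays with items
0716/0737/0670 (CrysPositional is consumed,

History (route lifecycle, newest last):
- 2026-08-15T13:45:22Z · CLOSED retired — not-a-thesis: assembly does not conclude the sub-problem Statement (operator:999:1257524)

sub-problem: Crystallization · status: closed(retired) · opened planner-plancard-AtomisticToContinuum-Crystal-c2a496bb-0 2026-08-15T11:24:16Z · rev 0 · ledger route-AtomisticToContinuum-PRDenominatorTransfer
GENERATED by the gate from the ledger (D-0016/17). Provers cite these decls: `theorem foo : Summit.AtomisticToContinuum.Crystallization.Theses.PRDenominatorTransfer.<Decl> := …` in Summits/AtomisticToContinuum/Crystallization/Theorems/<Name>.lean.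
-/

namespace Summit.AtomisticToContinuum.Crystallization.Theses.PRDenominatorTransfer

open scoped BigOperators Topology Manifold Classical MeasureTheory ProbabilityTheory Matrix InnerProductSpace ComplexConjugate ContinuousMap
open Filter Set Function TopologicalSpace MeasureTheory

attribute [summit_statement] _root_.Crystallization

/-- item stmt-AtomisticToContinuum-3788 · target · rank 0 · closed · moot by None · by planner
why it might fail: (Q) is strictly stronger than conjunct (i) (site-variance term); one ground-state family with Var(s)/mean(t) above its PR-deficit refutes X1 while crystallization may still hold; X2 is conjunct (ii) itself.
sources: BlancLewin2015, Yuhjtman2015, LennardJonesIngham1925, Stillinger2001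
[target] X = GroundStateVarianceCertificate ∧ CrysPositional as in § Thesis. -/
@[route_item "route-AtomisticToContinuum-PRDenominatorTransfer"]
def Target : Prop :=
  (∃ (P : Literature.MathematicalPhysics.StatisticalMechanics.PeriodicConfiguration 3) (C : ℝ), 0 < C ∧ P.energyPerParticle Literature.MathematicalPhysics.StatisticalMechanics.lennardJones ≤ -(C / 24) ∧ ∀ (N : ℕ) (x : Fin N → EuclideanSpace ℝ (Fin 3)), Literature.MathematicalPhysics.StatisticalMechanics.IsGroundState Literature.MathematicalPhysics.StatisticalMechanics.lennardJones x → ∑ i, (Literature.MathematicalPhysics.StatisticalMechanics.siteEnergy (fun r => (r⁻¹) ^ 6) x i) ^ 2 ≤ C * ∑ i, Literature.MathematicalPhysics.StatisticalMechanics.siteEnergy (fun r => (r⁻¹) ^ 12) x i) ∧ Literature.MathematicalPhysics.StatisticalMechanics.IsCrystallizing Literature.MathematicalPhysics.StatisticalMechanics.lennardJones 3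

/-- item stmt-AtomisticToContinuum-3789 · crux · rank 2 · closed · moot by None · by planner
why it might fail: Ψ = 2PR/N + Var(s)/mean(t): a ground-state family whose site variance beats its PR deficit (strained/defective bulk, Frank–Kasper-like or modulated close packings; phonon-test margin only 0.29) refutes it even if hcp is the LJ ground state; sharp far field.
sources: Yuhjtman2015, BlancLewin2015, Stillinger2001, BeterminSamajTravenec2022, Hales2012, Literature.Barriers.AtomisticToContinuum.TetrahedralFrustration
[crux] there are a periodic configuration P of ℝ³ and C > 0 with e_LJ(P) ≤ −C/24 such that for every
N and every Lennard-Jones ground state x of N particles, Σ_i s_i(x)² ≤ C·Σ_i t_i(x) (card item X_G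
in its logically equivalent weight-free form; intended P = relaxed hcp, C = Φ(hcp) = L₆²/L₁₂ =
17.222; forces e(P) = −C/24 = min over periodic configurations). [difficulty: open-problem] -/
@[route_item "route-AtomisticToContinuum-PRDenominatorTransfer"]
def GroundStateVarianceCertificate : Prop :=
  ∃ (P : Literature.MathematicalPhysics.StatisticalMechanics.PeriodicConfiguration 3) (C : ℝ), 0 < C ∧ P.energyPerParticle Literature.MathematicalPhysics.StatisticalMechanics.lennardJones ≤ -(C / 24) ∧ ∀ (N : ℕ) (x : Fin N → EuclideanSpace ℝ (Fin 3)), Literature.MathematicalPhysics.StatisticalMechanics.IsGroundState Literature.MathematicalPhysics.StatisticalMechanics.lennardJones x → ∑ i, (Literature.MathematicalPhysics.StatisticalMechanics.siteEnergy (fun r => (r⁻¹) ^ 6) x i) ^ 2 ≤ C * ∑ i, Literature.MathematicalPhysics.StatisticalMechanics.siteEnergy (fun r => (r⁻¹) ^ 12) x i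

/-- item stmt-AtomisticToContinuum-3790 · crux · rank 3 · closed · moot by None · by planner
why it might fail: adding far points always raises Ψ slightly (halo effect) and s² rewards heterogeneity: an engineered multi-scale finite configuration (compressed core, weightless periphery, interfaces of two densities) might push Σs²/Σt above Φ(hcp) although no ground state does.
sources: LennardJonesIngham1925, KiharaKoba1952, Yuhjtman2015, BlancLewin2015, Literature.Barriers.AtomisticToContinuum.IcosahedralClusters
[crux] the same certificate for EVERY finite configuration of distinct points in ℝ³ (scale-free, no
minimal-distance or ground-state input): ∃ P, C > 0, e_LJ(P) ≤ −C/24 ∧ ∀ injective x, Σ_i s_i² ≤ C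
Σ_i t_i. Equivalently sup_X Σs²/Σt is attained, in the limit, by a periodic configuration; this is
the natural target of a local equivariant transfer rule (the rule cannot see whether x is a ground
state) and implies crux 2 trivially. [difficulty: open-problem] -/
@[route_item "route-AtomisticToContinuum-PRDenominatorTransfer"]
def VarianceCertificate : Prop :=
  ∃ (P : Literature.MathematicalPhysics.StatisticalMechanics.PeriodicConfiguration 3) (C : ℝ), 0 < C ∧ P.energyPerParticle Literature.MathematicalPhysics.StatisticalMechanics.lennardJones ≤ -(C / 24) ∧ ∀ (N : ℕ) (x : Fin N → EuclideanSpace ℝ (Fin 3)), Function.Injective x → ∑ i, (Literature.MathematicalPhysics.StatisticalMechanics.siteEnergy (fun r => (r⁻¹) ^ 6) x i) ^ 2 ≤ C * ∑ i, Literature.MathematicalPhysics.StatisticalMechanics.siteEnergy (fun r => (r⁻¹) ^ 12) x i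

/-- item stmt-AtomisticToContinuum-3791 · crux · rank 4 · closed · moot by None · by planner
why it might fail: same variance strengthening in d = 2 (phonon ratio 2/3 exactly at long waves, margin 1/3); planner's hill-climb reached Ψ = 6.405 at N = 127 still rising (pointwise max 6.755 < 6.764): a large engineered cluster could cross Φ_tri.
sources: Theil2006, BlancLewin2015, Betermin2023, BeterminZhang2015, Literature.Barriers.AtomisticToContinuum.LocalizedPotentialsExcludeLennardJones
[crux] the planar rung: ∃ P : PeriodicConfiguration 2 (intended: triangular lattice, Φ_tri = L₆²/L₁₂
= 6.3759²/6.0098 = 6.764), C > 0, e_LJ(P) ≤ −C/24 ∧ ∀ finite injective x ⊂ ℝ², Σ s_i² ≤ C Σ t_i.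
Gives conjunct (i) for the TRUE (12,6) potential in d = 2, which Theil2006's hypotheses exclude; the
kissing configuration (hexagon) is rigid there, so this is where a transfer-free or one-transfer
proof should exist if the mechanism is real. [difficulty: L] -/
@[route_item "route-AtomisticToContinuum-PRDenominatorTransfer"]
def PlanarVarianceCertificate : Prop :=
  ∃ (P : Literature.MathematicalPhysics.StatisticalMechanics.PeriodicConfiguration 2) (C : ℝ), 0 < C ∧ P.energyPerParticle Literature.MathematicalPhysics.StatisticalMechanics.lennardJones ≤ -(C / 24) ∧ ∀ (N : ℕ) (x : Fin N → EuclideanSpace ℝ (Fin 2)), Function.Injective x → ∑ i, (Literature.MathematicalPhysics.StatisticalMechanics.siteEnergy (fun r => (r⁻¹) ^ 6) x i) ^ 2 ≤ C * ∑ i, Literature.MathematicalPhysics.StatisticalMechanics.siteEnergy (fun r => (r⁻¹) ^ 12) x i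

/-- item stmt-AtomisticToContinuum-3792 · crux · rank 5 · closed · moot by None · by planner
why it might fail: asserts two open facts at once: fcc maximises L₆²/L₁₂ among 3-D lattices (only numerics, BeterminSamajTravenec2022) and e(hcp) < e(fcc) for full-range LJ by a 1e-4 relative margin (Stillinger2001); a non-cubic lattice inside that margin kills it.
sources: BeterminSamajTravenec2022, Betermin2023, Stillinger2001, KiharaKoba1952, Literature.Barriers.AtomisticToContinuum.NoUniversallyOptimalLattice3D, Literature.Barriers.AtomisticToContinuum.HcpNotBravais
[crux] the variance-free slice, pinned to hcp: there are a, h ≠ 0 such that for every Bravais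
lattice L of ℝ³ (periodic configuration with one-point motif) L₆(L)² ≤ (−24·e_LJ(hcp_{a,h}))·L₁₂(L),
i.e. no Bravais lattice at any density beats relaxed hcp for Lennard-Jones (expected: max_L L₆²/L₁₂
= Φ(fcc) = 17.2203 < 17.2225 ≈ Φ(relaxed hcp); certified lattice sums + a 5-parameter optimisation
over lattice shapes with cusp asymptotics). [difficulty: M] -/
@[route_item "route-AtomisticToContinuum-PRDenominatorTransfer"]
def LatticeQuotientBound : Prop :=
  ∃ (a h : ℝ) (ha : a ≠ 0) (hh : h ≠ 0), ∀ Q : Literature.MathematicalPhysics.StatisticalMechanics.PeriodicConfiguration 3, Q.motif.card = 1 → 2 * (Q.energyPerParticle (fun r => (r⁻¹) ^ 6)) ^ 2 ≤ (-(24 : ℝ) * (Literature.MathematicalPhysics.StatisticalMechanics.hcpPeriodicConfiguration ha hh).energyPerParticle Literature.MathematicalPhysics.StatisticalMechanics.lennardJones) * Q.energyPerParticle (fun r => (r⁻¹) ^ 12)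

/-- item stmt-AtomisticToContinuum-0625 · crux · rank 6 · open · by planner
why it might fail: it is half the conjecture: stacking-disordered ground states without periodic windows of diverging size (third-shell selection J₂ < 0 uncertified, Hägg domination 0737 open) would refute it while (i) survives.
sources: BlancLewin2015, FlatleyTheil2015, Literature.Barriers.AtomisticToContinuum.KissingTwelveDegeneracy, Literature.Barriers.AtomisticToContinuum.ShortRangeStackingBlindness
Blanc–Lewin positional crystallization for Lennard-Jones in ℝ³ (conjunct (ii) itself): the route's
content is (a) local optimality + (b) rigidity for a PAIR potential in 3-D without Flatley–Theil's
auxiliary three-body term (arXiv:1407.0692 Thm 1.1, p.4) + (c) periodic optimal stacking ⇒ every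
vague limit of translated ground states along a subsequence is a non-zero window of a periodic
optimal stacking. -/
@[route_item "route-AtomisticToContinuum-PRDenominatorTransfer"]
def CrysPositional : Prop :=
  Literature.MathematicalPhysics.StatisticalMechanics.IsCrystallizing Literature.MathematicalPhysics.StatisticalMechanics.lennardJones 3

/-- item stmt-AtomisticToContinuum-0629 · support · rank 9 · closed · moot by None · by planner
sources: BlancLewin2015
Easy half of energetic crystallization: limsup E(N)/N ≤ ⨅ over periodic configurations of the LJ
energy per particle (finite blocks of a near-optimal periodic configuration as trial states;
boundary O(N^{2/3}); r⁻⁶ tail summable in d = 3; needs BddBelow of the range, from LJ stability). -/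
@[route_item "route-AtomisticToContinuum-PRDenominatorTransfer"]
def CrysEnergyUpper : Prop :=
  Filter.limsup (fun N : ℕ => Literature.MathematicalPhysics.StatisticalMechanics.groundStateEnergy Literature.MathematicalPhysics.StatisticalMechanics.lennardJones 3 N / N) Filter.atTop ≤ ⨅ Q : Literature.MathematicalPhysics.StatisticalMechanics.PeriodicConfiguration 3, Q.energyPerParticle Literature.MathematicalPhysics.StatisticalMechanics.lennardJones

/-- item stmt-AtomisticToContinuum-0714 · support · rank 9 · closed · proved by Summit.AtomisticToContinuum.Crystallization.Theorems.crysPeriodicBddBelow_proof (prover) · by planner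
sources: BlancLewin2015
The Lennard-Jones energy per particle of periodic configurations of ℝ³ (any full-rank lattice, any
finite motif) is bounded below (by −B, the stability constant: finite blocks of Q as N-point
configurations, boundary O(N^{2/3}), r⁻⁶ tail summable in d = 3). Makes ⨅_Q e(Q) a genuine infimum
(ciInf_le usable) in 0626/0629 and in the periodisation lemma. -/
@[route_item "route-AtomisticToContinuum-PRDenominatorTransfer"]
def CrysPeriodicBddBelow : Prop :=
  BddBelow (Set.range fun Q : Literature.MathematicalPhysics.StatisticalMechanics.PeriodicConfiguration 3 => Q.energyPerParticle Literature.MathematicalPhysics.StatisticalMechanics.lennardJones)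

/-- item stmt-AtomisticToContinuum-3793 · support · rank 9 · closed · moot by None · by planner
sources: LennardJonesIngham1925, BlancLewin2015
[support] Cauchy–Schwarz + dilation, pure algebra in any dimension: if 0 ≤ C and Σ_i s_i² ≤ C Σ_i
t_i for an injective configuration x of N points, then interactionEnergy lennardJones x ≥ −(C/24)·N
(proof: with A = Σ_{i<j} r⁻⁶ = ½Σs_i, B = Σ_{i<j} r⁻¹² = ½Σt_i > 0 one has E = B/12 − A/6 = (B −
A)²/(12B) − A²/(12B) ≥ −A²/(12B), and (Σ s_i)² ≤ N Σ s_i² ≤ N·C·Σ t_i; N ≤ 1 is 0 ≤ 0). [difficulty: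
provable-now] -/
@[route_item "route-AtomisticToContinuum-PRDenominatorTransfer"]
def CertificateBoundsEnergy : Prop :=
  ∀ (C : ℝ), 0 ≤ C → ∀ (d N : ℕ) (x : Fin N → EuclideanSpace ℝ (Fin d)), Function.Injective x → ∑ i, (Literature.MathematicalPhysics.StatisticalMechanics.siteEnergy (fun r => (r⁻¹) ^ 6) x i) ^ 2 ≤ C * ∑ i, Literature.MathematicalPhysics.StatisticalMechanics.siteEnergy (fun r => (r⁻¹) ^ 12) x i → -(C / 24 * N) ≤ Literature.MathematicalPhysics.StatisticalMechanics.interactionEnergy Literature.MathematicalPhysics.StatisticalMechanics.lennardJones x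

/-- item stmt-AtomisticToContinuum-3794 · assembly · rank 1 · closed · moot by None · by planner
sources: BlancLewin2015
[assembly] GroundStateVarianceCertificate → CertificateBoundsEnergy → CrysEnergyUpper →
CrysPeriodicBddBelow → CrysPositional → Crystallization. -/
@[route_item "route-AtomisticToContinuum-PRDenominatorTransfer"]
def Assembly : Prop :=
  GroundStateVarianceCertificate → CertificateBoundsEnergy → CrysEnergyUpper → CrysPeriodicBddBelow → CrysPositional → Literature.MathematicalPhysics.StatisticalMechanics.Crystallization

end Summit.AtomisticToContinuum.Crystallization.Theses.PRDenominatorTransfer
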